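import Mathlib
import HarnessLib
import Literature.Combinatorics.Optimization.LowAutocorrelation

/-!
# LABS: a kernel-certified witness `labsMin 54 ≤ 175`

Companion to `Literature.Combinatorics.Optimization.LowAutocorrelationWitnesses` (witness upper bounds for
`8 ≤ N ≤ 45`). This file records one explicit length-54 sequence whose sidelobe energy `decide` evaluates to
`175` (merit factor `54² / 350 ≈ 8.33`), giving `LABS.labsMin 54 ≤ 175` by `LABS.labsMin_le_energy`.

Why it is recorded separately: the table of Brglez, Li, Stallmann and Militzer (2003, "Reliable cost predictions
for finding optimal solutions to LABS problem", Fig. 3(b)) lists `E = 183` for `L = 54` with the footnote "values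
shown for L < 61 are known to be optimal"; the witness below has energy `175 < 183`, so that table entry is not
the optimum. Whether `175` is optimal is NOT asserted here (Packebusch–Mertens [PackebuschMertens2016] report
exhaustive optima for all `N ≤ 66`; their table is not reproduced in this library). The sequence was found by the
`pub-qadeq` lane's memetic tabu search runs (14 of 24 independent runs at `N = 54` returned energy-175 sequences)
and its energy was re-verified by two further independent implementations before being typed here.
No named facts, no axioms beyond the three standard ones.

Witness (`+` = `true` = spin `+1`, `-` = `false` = spin `−1`): `+-++-+-++-+-+--++--+-+---+-+++---++++--++--+++++++++--`.
-/

namespace Literature.Combinatorics.Optimization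

namespace LABS

/-- `E_min(54) ≤ 175`, by the explicit witness `+-++-+-++-+-+--++--+-+---+-+++---++++--++--+++++++++--` whose energy `decide` evaluates
to `175`. (Brglez et al. 2003 tabulate `183` as optimal for `L = 54`; this witness refutes that entry. Optimality of `175` is not
asserted here; cf. [cite: PackebuschMertens2016, Table 1].) -/
theorem labsMin_le_54 : labsMin 54 ≤ 175 :=
  le_of_le_of_eq (labsMin_le_energy (N := 54) ![true, false, true, true, false, true, false, true, true, false, true, false, true, false, false, true, true, false, false, true, false, true, false, false, false, true, false, true, true, true, false, false, false, true, true, true, true, false, false, true, true, false, false, true, true, true, true, true, true, true, true, true, false, false])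
    (by set_option maxRecDepth 400000 in set_option maxHeartbeats 800000000 in decide)

end LABS

end Literature.Combinatorics.Optimization
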